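import Mathlib
import Literature.Analysis.FluidPDE.AxisymmetricNoSwirlGlobalHolds
import Literature.Analysis.FluidPDE.KNSSNoAxisymmetricTypeIHolds
import Literature.Analysis.FluidPDE.GigaMiura2011ScaledAlignmentTypeIHolds
import Literature.Analysis.FluidPDE.BarkerPrange2020VorticityAlignmentTypeIHolds
import Literature.Analysis.FluidPDE.LiouvilleExcludesLocalTypeI
import Literature.Analysis.FluidPDE.Seregin2023.TypeIIScenarioExcluded
import Literature.Analysis.FluidPDE.ChaeTypeIIProfileSteadyLimit
import Literature.Analysis.FluidPDE.Seregin2024AxisymTypeIIScenarioHolds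
import Literature.Analysis.FluidPDE.LeiZhang2017SmallSwirlProof
import Literature.Analysis.FluidPDE.Wei2016AprioriHolds
import Literature.Analysis.FluidPDE.LeiZhang2011RegularityHolds
import Literature.Analysis.FluidPDE.KNSSSwirlLiouville
import Literature.Analysis.FluidPDE.KNSSThm53OfWindow
import Literature.Analysis.FluidPDE.NSEssEndpointHolds
import Literature.Analysis.FluidPDE.NSSereginL3BlowupHolds
import Literature.Analysis.FluidPDE.CheskidovShvydkoyRegularProofs
import Literature.Analysis.FluidPDE.NSViscosityRescaling
import Literature.Analysis.FunctionSpaces.WeakLp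
import Literature.Analysis.FluidPDE.PartialRegularityHolds
import Literature.Analysis.FluidPDE.SchefferSingularTimesProofs
import Literature.Analysis.FluidPDE.NSStrongSolutions2DProofs
import Literature.Analysis.FluidPDE.BeltramiFlowLiouville
import Literature.Analysis.FluidPDE.NearBeltramiEnstrophyCriterion
import Summits.NavierStokesRegularity.NavierStokesRegularity.Theorems.LiouvilleConjectureNS
import Summits.NavierStokesRegularity.NavierStokesRegularity.Theorems.AxisymmetricSwirlRegularity
import HarnessLib.Audit
import HarnessLib

/-!
# Blow-up scenario census — block F: FORWARD first-time singularity from smooth decaying data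

Cell `pub/ns-census` (director-ns KEY req102, 2026-08-28; D-0154 (A)).  Typed companion of block F
(rows F0–F16) of the lead's `SCENARIO-CENSUS.md` v1.1 (seat ns-census-lead g2; keys fixed there).
Per row: `Row_<key> : Prop` — the exact exclusion / regularity statement of the cell over tree
predicates (OPEN rows are `@[conjecture]` obligation nodes, nothing asserted; a row whose statement
IS a named Literature fact aliases it by name, for table uniformity, and is no restatement) — and,
for EXCLUDED-IN-TREE rows, the one-liner `theorem row_<key>_excluded : Row_<key> := <tree decl>`.
Glue between rows is one-line bookkeeping.  **Nothing in this file is a claim about Navier–Stokes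
regularity; no summit statement is proved by this seat.**

Frame (Clay class): `ν > 0`, `0 < T`, `(u, p)` classical on `ℝ³ × [0,T)`
(`IsClassicalNSSolutionOn (Ico 0 T) ν 0 u p`), Leray–Hopf from its datum (`IsLerayHopfOn T ν 0 (u 0) u`),
`u 0` rapidly decaying (`HasRapidSpatialDecay`); blow-up at `T` = `IsMaximalSmoothSolution`
(classical ∧ `¬ HasSmoothExtensionPast`); Type I = `IsTypeIBlowup u T`, Type II = not Type I.
Rows quoting a tree theorem keep its exact hypotheses (census refuter audits class ⊇ cell).

| key | cell (type · symmetry · class) | value / Lean |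
|---|---|---|
| F0 | I∨II · none · Clay | OPEN — `Row_F0` (= item ⟨0054⟩ verbatim); `row_F0_of_F1_F4` |
| F1 | I · none · Clay | OPEN-WITH-LINE — `Row_F1`; mod (L): `STH.typeIExtends_of_liouvilleConjectureNS : (L) → Row_F1` (cited, see below) |
| F1a | I, eventual rate C² < 2ν | EXCLUDED — `STH.TypeITraceScarL3.typeITraceScarL3_of_eventualRate_sq_lt_two_nu` (cited only) |
| F1b | I + continuous vorticity direction | EXCLUDED — `Row_F1b := gigaMiura_continuousAlignment_typeI`, `_holds` |
| F1c | I + concentrating alignment | EXCLUDED — `Row_F1c := barkerPrange2020_alignment_concentrating_typeI`, `_holds` |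
| F1d | I + one structural door | EXCLUDED — the `Local…Door` route targets `_holds` (gate-appended; cited only) |
| F1e | I · none · suitable weak, local point | OPEN — `Row_F1e := ¬ LocalTypeISingularityExists`; `row_F1e_of_liouville` |
| F2 | I (or `r‖u‖ ≤ C`) · axisym · Clay + bounded sub-strips | EXCLUDED — `Row_F2 := knss_no_axisymmetric_typeI` |
| F3 | I∨II · axisym no swirl · smooth decaying data | EXCLUDED — `Row_F3 := axisymmetric_no_swirl_global_regularity` |
| F4 | II · none · Clay | OPEN-WITH-LINE — `Row_F4` (= crux ⟨0056⟩ verbatim) |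
| F4a | II, Seregin's continuous-weight scenario | EXCLUDED — `Row_F4a := Seregin2023.seregin2026_typeII_scenario_excluded_continuousWeight` |
| F4b | II, asymptotically self-similar, `L^p` profile, `3 < p ≤ 9/2` | EXCLUDED — `Row_F4b` / `chae2010_typeII_asymptoticallySelfSimilar_of_le_nineHalves` |
| F4b′ | same, `p > 9/2` | PRINT — fact `chae2010_typeII_asymptoticallySelfSimilar` (no `_holds`; cited only) |
| F5 | II (= all, by F2) · axisym with swirl · Clay + bounded sub-strips | OPEN (restating) — `Row_F5`; data form = leaf `SUM.AxisymmetricSwirlRegularity` |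
| F5a | II, Seregin 2024 axisym scenario | EXCLUDED — `Row_F5a` (∧ of the `_Lq` / `_vorticity` facts) |
| F5b | axisym criteria (small swirl, log modulus, BMO⁻¹ stream, KNSS swirl) | EXCLUDED — `Row_F5b` (∧ of four facts) |
| F5c | axisym ∩ `L^∞_t L^{3,∞}_x` | PRINT — facts `ozanskiPalasek2022_axisym_weakL3_quantitative/_blowup_rate` (cited only) |
| F6 | I∨II · none · `L^∞_t L³_x` / LPS / `‖u(t)‖₃ → ∞` | EXCLUDED — `Row_F6 := ess_endpoint ∧ seregin_L3_blowup ∧ ladyzhenskaya_prodi_serrin` |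
| F6′ | Tao's quantitative `L³` rate | PRINT — fact `tao_L3_blowup_rate` (cited only) |
| F6b | supercritical Serrin `L^q_t L³_x`, `q ∈ (4,5)` | OPEN-WITH-LINE — `Row_F6b` (= item ⟨19500⟩ verbatim) |
| F7 | I∨II · none · `L^∞_t L^{3,∞}_x`, large | OPEN-NO-LINE — `Row_F7`; mod (L) in tree (cited below) |
| F8 | `L^∞_t Ḣ^{1/2}_x` | PRINT (Kenig–Koch 2011); vocabulary exists (`Function.eHomSobolevSeminorm (1/2) (complexify ∘ ·)`, embedding `eLpNorm_three_le_eHomSobolevSeminorm_half_holds`, small data `BAR….exists_clayA_of_small_homSobolevHalf`); untyped per census §6 |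
| F8′ | Lorentz `L^{3,q}` / Besov | PRINT; tree fact `albritton_besov_blowup` is deprecated (mis-stated), no `_holds` |
| F9 | suitable weak: fat singular sets | EXCLUDED — `Row_F9 := ckn_partial_regularity ∧ scheffer_singular_times` |
| F10 | planar 2D, `𝕋²` | EXCLUDED — `Row_F10 := fmrt_strong_existence_torus2` |
| F11/F12 | 2½-D / helical on `ℝ³` | VACUOUS / NO-VOCAB — docstring only |
| F13 | I∨II · finite symmetry group · Clay | OPEN-NO-LINE — `Row_F13`; `row_F13_of_F0` |
| F14 | exact Beltrami datum, finite energy | VACUOUS → EXCLUDED — `Row_F14` / `IsBeltrami.eq_zero_of_integrable_norm_rpow` |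
| F14′ | near-Beltrami, BKM class (Farhat–Grujić, whole space) | EXCLUDED — `Row_F14'` / `nearBeltrami_enstrophy_criterion` |
| F15 | `𝕋³`, Clay (B) | OPEN — leaf `SUM.NavierStokesExistenceSmoothPeriodic` by name (𝕋³ twins of F2–F9: not in tree) |
| F16 | forced breakdown (Clay C/D) | annex — leaves `SUM.NavierStokesBreakdownR3/…Periodic` by name |

Cited-only rows: their decls live in `Theorems/` modules that import a route file (theses-cone lint),
or are undischarged named facts; the census markdown carries them by name.  Conditional links cited
by name: `STH.typeIExtends_of_liouvilleConjectureNS` (`Theorems/TypeILiouvilleLKillsTypeI.lean`, =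
`(L) → Row_F1`, item ⟨10662⟩ closed) and `STH.TypeIliouvilleNoTypeII.TypeIIZoom.hasSmoothExtensionPast_of_weakL3Slab_of_liouvilleL`
(`…NoTypeIIWeakL3ModL.lean`, = `(L) → Row_F7`).  `STH.` = `Summit.NavierStokesRegularity.NavierStokesRegularity.Theorems.`,
`SUM.` = `Summit.NavierStokesRegularity.NavierStokesRegularity.`.  HOUSEKEEPING: an earlier submission of this
file (p607637, 2026-08-28) had its ALIAS rows relocated by the gate's inline-`cite` rule to
`Literature/Uncategorized/RowF1b.lean` (`Literature.Uncategorized.Row_F1b`, …); that module is NOT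
imported or referenced by anything, is superseded by the aliases below, and is flagged for retirement.
-/

noncomputable section

-- the summit and its single problem share the name `NavierStokesRegularity` (D-0017 nested layout)
set_option linter.dupNamespace false

open Set Function Filter Topology MeasureTheory Metric
open scoped NNReal ENNReal ContDiff

namespace Summit.NavierStokesRegularity.NavierStokesRegularity.Theorems.ScenarioCensus

open Literature.Analysis Literature.Analysis.FluidPDE Literature.Analysis.FunctionSpaces

/-! ## F0 / F1 / F4: no symmetry, Clay class -/

/-- **Row F0** (I∨II · no symmetry · Clay class): no first-time singularity — every classical
Leray–Hopf solution on `ℝ³ × [0,T)` from a rapidly decaying datum extends past `T`.  Verbatim item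
⟨0054⟩ `TypeILiouville.TypeIliouvilleThesis`; returns Clay (A) via the closed assembly ⟨0055⟩.  OPEN.
[cite: KochNadirashviliSereginSverak2009, §1 (arXiv:0709.3599)] -/
@[conjecture] def Row_F0 : Prop :=
  ∀ (ν T : ℝ), 0 < ν → 0 < T →
    ∀ (u : ℝ → EuclideanSpace ℝ (Fin 3) → EuclideanSpace ℝ (Fin 3))
      (p : ℝ → EuclideanSpace ℝ (Fin 3) → ℝ),
    IsClassicalNSSolutionOn (Ico 0 T) ν 0 u p → IsLerayHopfOn T ν 0 (u 0) u →
    HasRapidSpatialDecay (u 0) → HasSmoothExtensionPast ν 0 u T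

/-- **Row F1** (Type I · no symmetry · Clay class): a classical Leray–Hopf solution from a rapidly
decaying datum with at most the Type I rate at `T` extends past `T`.  OPEN-WITH-LINE (target ⟨1217⟩;
⟨18385⟩, ⟨1574⟩, ⟨24077⟩, ⟨23843⟩); proved MODULO (L) = ⟨10661⟩ by
`STH.typeIExtends_of_liouvilleConjectureNS : (L) → Row_F1` (⟨10662⟩ closed; cited, not imported).
[cite: KochNadirashviliSereginSverak2009, §1 conjecture (L) and §6 Prop. 6.1 (arXiv:0709.3599)] -/
@[conjecture] def Row_F1 : Prop :=
  ∀ (ν T : ℝ), 0 < ν → 0 < T →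
    ∀ (u : ℝ → EuclideanSpace ℝ (Fin 3) → EuclideanSpace ℝ (Fin 3))
      (p : ℝ → EuclideanSpace ℝ (Fin 3) → ℝ),
    IsClassicalNSSolutionOn (Ico 0 T) ν 0 u p → IsLerayHopfOn T ν 0 (u 0) u →
    HasRapidSpatialDecay (u 0) → IsTypeIBlowup u T → HasSmoothExtensionPast ν 0 u T

/-- **Row F4** (Type II excluded · no symmetry · Clay class): a maximal classical Leray–Hopf
solution from a rapidly decaying datum blows up at the Type I rate.  Verbatim the hard-core crux
⟨0056⟩ `TypeILiouville.TypeIliouvilleNoTypeII` (≈30 routes; live line ⟨19832⟩).  OPEN-WITH-LINE.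
[cite: KochNadirashviliSereginSverak2009, §1 (Type I / II; arXiv:0709.3599 p. 4)] -/
@[conjecture] def Row_F4 : Prop :=
  ∀ (ν T : ℝ), 0 < ν → 0 < T →
    ∀ (u : ℝ → EuclideanSpace ℝ (Fin 3) → EuclideanSpace ℝ (Fin 3))
      (p : ℝ → EuclideanSpace ℝ (Fin 3) → ℝ),
    IsMaximalSmoothSolution ν 0 u p T → IsLerayHopfOn T ν 0 (u 0) u →
    HasRapidSpatialDecay (u 0) → IsTypeIBlowup u T

/-- `row_F0_iff`, forward half: F1 (Type I excluded) and F4 (Type II excluded) give F0. [folklore] -/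
theorem row_F0_of_F1_F4 (h₁ : Row_F1) (h₄ : Row_F4) : Row_F0 := by
  intro ν T hν hT u p hcl hLH hdec
  by_contra hext
  exact hext (h₁ ν T hν hT u p hcl hLH hdec (h₄ ν T hν hT u p ⟨hcl, hext⟩ hLH hdec))

/-- `row_F0_iff`, converse: F0 gives F1 … [folklore] -/
theorem row_F1_of_F0 (h₀ : Row_F0) : Row_F1 :=
  fun ν T hν hT u p hcl hLH hdec _ => h₀ ν T hν hT u p hcl hLH hdec

/-- … and F4 (vacuously: no maximal solution). [folklore] -/
theorem row_F4_of_F0 (h₀ : Row_F0) : Row_F4 :=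
  fun ν T hν hT u p hmax hLH hdec => (hmax.2 (h₀ ν T hν hT u p hmax.1 hLH hdec)).elim

/-! ## F1b / F1c / F1e: Type I with structure; local Type I -/

/-- **Row F1b** (Type I + continuous vorticity direction, Giga–Miura): ALIAS of the fact
`gigaMiura_continuousAlignment_typeI`, PROVED.  EXCLUDED-IN-TREE. (ref: GigaMiura2011, Thm 1.2) -/
def Row_F1b : Prop := gigaMiura_continuousAlignment_typeI

/-- Row F1b is a theorem of the tree. [cite: GigaMiura2011, Thm 1.2] -/
theorem row_F1b_excluded : Row_F1b := gigaMiura_continuousAlignment_typeI_holds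

/-- **Row F1c** (Type I + concentrating vorticity alignment, Barker–Prange 2020 Thm 3): ALIAS of
`barkerPrange2020_alignment_concentrating_typeI`, PROVED.  EXCLUDED-IN-TREE.
(ref: BarkerPrange2020Alignment, Thm. 3 (arXiv:1906.08225 §5.2)) -/
def Row_F1c : Prop := barkerPrange2020_alignment_concentrating_typeI

/-- Row F1c is a theorem of the tree. [cite: BarkerPrange2020Alignment, Thm. 3] -/
theorem row_F1c_excluded : Row_F1c := barkerPrange2020_alignment_concentrating_typeI_holds

/-- **Row F1e** (Type I · suitable weak class · interior point): no suitable weak solution has a local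
Type I singular point in the sense of Albritton–Barker 2019 — negation of the registered open
statement `LocalTypeISingularityExists` (⇔ `¬ NontrivialMildAncientTypeIExists` = ancient row A2 by
`AlbrittonBarkerTypeICharacterization_holds`).  OPEN-WITH-LINE; mod (L): `row_F1e_of_liouville`.
[cite: AlbrittonBarker2019, Thm 1.1 and §1] -/
@[conjecture] def Row_F1e : Prop := ¬ LocalTypeISingularityExists

/-- Row F1e holds under (L) (`not_localTypeISingularityExists_of_liouvilleConjectureNS`).
[cite: AlbrittonBarker2019, §1 (paragraph after Thm 1.1)] -/
theorem row_F1e_of_liouville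
    (hL : Summit.NavierStokesRegularity.NavierStokesRegularity.LiouvilleConjectureNS) : Row_F1e :=
  not_localTypeISingularityExists_of_liouvilleConjectureNS hL

/-! ## F2 / F3 / F5: axisymmetric classes -/

/-- **Row F2** (Type I, or `r‖u‖ ≤ C` · axisymmetric, swirl allowed · Clay class, bounded on closed
sub-strips): such a solution extends past `T` — ALIAS of `knss_no_axisymmetric_typeI` (KNSS 2009
Thms 6.1–6.2; Seregin–Šverák 2009), PROVED.  EXCLUDED-IN-TREE ("every axisymmetric singularity is
Type II"). (ref: KochNadirashviliSereginSverak2009, Thms 6.1–6.2 (arXiv:0709.3599 pp. 11–12)) -/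
def Row_F2 : Prop := knss_no_axisymmetric_typeI

/-- Row F2 is a theorem of the tree. [cite: KochNadirashviliSereginSverak2009, Thm 6.2] -/
theorem row_F2_excluded : Row_F2 := knss_no_axisymmetric_typeI_holds

/-- **Row F3** (I∨II · axisymmetric without swirl · smooth decaying data): global regularity —
ALIAS of `axisymmetric_no_swirl_global_regularity` (Ladyzhenskaya / Ukhovskii–Yudovich 1968), PROVED.
EXCLUDED-IN-TREE. (ref: LemarieRieusset2016, Thm 10.4 (p. 285)) -/
def Row_F3 : Prop := axisymmetric_no_swirl_global_regularity

/-- Row F3 is a theorem of the tree. [cite: LemarieRieusset2016, Thm 10.4 (p. 285)] -/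
theorem row_F3_excluded : Row_F3 := axisymmetric_no_swirl_global_regularity_holds

/-- **Row F5** (II = all blow-up by F2 · axisymmetric WITH swirl · Clay class, bounded on closed
sub-strips): a classical Leray–Hopf solution from a rapidly decaying datum with axisymmetric slices
extends past `T`.  Data form = leaf `SUM.AxisymmetricSwirlRegularity` (hard cores ⟨1964⟩, ⟨15453⟩
restate the cell).  OPEN-WITH-LINE (restating).  Sub-cells in tree: F2, F5a, F5b.
[cite: KochNadirashviliSereginSverak2009, §5 (arXiv p. 10: swirl case open)] -/
@[conjecture] def Row_F5 : Prop :=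
  ∀ (ν T : ℝ), 0 < ν → 0 < T →
    ∀ (u : ℝ → EuclideanSpace ℝ (Fin 3) → EuclideanSpace ℝ (Fin 3))
      (p : ℝ → EuclideanSpace ℝ (Fin 3) → ℝ),
    IsClassicalNSSolutionOn (Ico 0 T) ν 0 u p → IsLerayHopfOn T ν 0 (u 0) u →
    HasRapidSpatialDecay (u 0) → (∀ T' < T, ∃ M : ℝ, ∀ t ∈ Icc 0 T', ∀ x, ‖u t x‖ ≤ M) →
    (∀ t ∈ Ico 0 T, IsAxisymmetric (u t)) → HasSmoothExtensionPast ν 0 u T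

/-- F0 contains F5. [folklore] -/
theorem row_F5_of_F0 (h₀ : Row_F0) : Row_F5 :=
  fun ν T hν hT u p hcl hLH hdec _ _ => h₀ ν T hν hT u p hcl hLH hdec

/-! ## F4a / F4b / F5a / F5b: excluded Type II sub-scenarios and axisymmetric criteria -/

/-- **Row F4a** (Type II, Seregin's weighted-energy concentration scenario with CONTINUOUS weight):
ALIAS of `Seregin2023.seregin2026_typeII_scenario_excluded_continuousWeight`, PROVED (the
letter-of-source constant-weight form is refuted in tree and NOT cited).  EXCLUDED-IN-TREE.
(ref: Seregin2026, Thm 2.1 (p. 5)) -/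
def Row_F4a : Prop := Seregin2023.seregin2026_typeII_scenario_excluded_continuousWeight

/-- Row F4a is a theorem of the tree. [cite: Seregin2026, Thm 2.1] -/
theorem row_F4a_excluded : Row_F4a :=
  Seregin2023.seregin2026_typeII_scenario_excluded_continuousWeight_holds

/-- **Row F4b** (Type II, asymptotically self-similar with `L^p`-convergent profile, `3 < p ≤ 9/2`;
Chae 2010 Thm 1.4): the profile `V` vanishes a.e.  The statement of the tree theorem
`chae2010_typeII_asymptoticallySelfSimilar_of_le_nineHalves`.  EXCLUDED-IN-TREE (`p > 9/2`: row
F4b′, fact `chae2010_typeII_asymptoticallySelfSimilar` without `_holds`).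
(ref: Chae2010, Thm 1.4 (= arXiv:0711.1113 Thm 3.1)) -/
def Row_F4b : Prop :=
  ∀ (T : ℝ), 0 < T → ∀ (p : ℝ≥0), 3 < p → (p : ℝ≥0∞) ≤ 9 / 2 →
    ∀ (v : ℝ → EuclideanSpace ℝ (Fin 3) → EuclideanSpace ℝ (Fin 3))
      (π : ℝ → EuclideanSpace ℝ (Fin 3) → ℝ),
    IsClassicalNSSolutionOn (Ioo 0 T) 1 0 v π → ContinuousInLpOn (Ico 0 T) p v →
    ∀ (γ : ℝ), 1 < γ → ∀ (V : EuclideanSpace ℝ (Fin 3) → EuclideanSpace ℝ (Fin 3)),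
    MemLp V (p : ℝ≥0∞) volume → Tendsto (chaeTypeIIDeviation T γ p v V) (𝓝[<] T) (𝓝 0) →
    eWeakGradL2Sq V < ⊤ → V =ᵐ[volume] 0

/-- Row F4b is a theorem of the tree. [cite: Chae2010, Thm 1.4] -/
theorem row_F4b_excluded : Row_F4b := fun _ hT _ hp3 hp92 _ _ hv hvc _ hγ _ hV hconv hH1 =>
  chae2010_typeII_asymptoticallySelfSimilar_of_le_nineHalves hT hp3 hp92 hv hvc hγ hV hconv hH1

/-- **Row F5a** (Type II, axisymmetric power-concentration scenario; Seregin 2024 Prop 2.3 /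
Cor 2.4): ALIAS of the conjunction of `seregin2024_axisym_typeII_scenario_excluded_Lq` and
`…_vorticity`, both PROVED.  EXCLUDED-IN-TREE. (ref: Seregin2024AxisymTypeII, Prop 2.3 and Cor 2.4 (§2 p. 7)) -/
def Row_F5a : Prop :=
  seregin2024_axisym_typeII_scenario_excluded_Lq ∧ seregin2024_axisym_typeII_scenario_excluded_vorticity

/-- Row F5a is a theorem of the tree. [cite: Seregin2024AxisymTypeII, Prop 2.3 and Cor 2.4] -/
theorem row_F5a_excluded : Row_F5a :=
  ⟨seregin2024_axisym_typeII_scenario_excluded_Lq_holds,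
    seregin2024_axisym_typeII_scenario_excluded_vorticity_holds⟩

/-- **Row F5b** (axisymmetric regularity CRITERIA inside F5: small swirl, log modulus of the swirl,
`BMO⁻¹` stream function, KNSS's bounded-weak swirl form): ALIAS of the conjunction of the four facts
`LeiZhang2017_smallSwirl_regularity`, `LeiZhang2017_logModulus_regularity`,
`LeiZhang2011_regularity_bmoStream`, `KNSS2009_regularity_axisymmetric_swirl`, all PROVED.
EXCLUDED-IN-TREE (criteria). (ref: LeiZhang2017, Thm 1.1 and Cor 1.3) -/
def Row_F5b : Prop :=
  LeiZhang2017_smallSwirl_regularity ∧ LeiZhang2017_logModulus_regularity ∧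
    LeiZhang2011_regularity_bmoStream ∧ KNSS2009_regularity_axisymmetric_swirl

/-- Row F5b is a theorem of the tree. [cite: LeiZhang2017, Thm 1.1 and Cor 1.3] -/
theorem row_F5b_excluded : Row_F5b :=
  ⟨LeiZhang2017_smallSwirl_regularity_holds, LeiZhang2017_logModulus_regularity_holds,
    LeiZhang2011_regularity_bmoStream_holds, KNSS2009_regularity_axisymmetric_swirl_holds⟩

/-! ## F6 / F6b / F7 / F9 / F10: critical classes, partial regularity, 2D -/

/-- **Row F6** (I∨II · no symmetry · `L^∞_t L³_x` / Ladyzhenskaya–Prodi–Serrin classes): critical-norm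
blow-up is necessary — ALIAS of `ess_endpoint ∧ seregin_L3_blowup ∧ ladyzhenskaya_prodi_serrin`
(ESS 2003 Thms 1.3–1.4; Seregin 2012 Thm 1.1: `‖u(t)‖₃ → ∞`; LPS), all PROVED.  EXCLUDED-IN-TREE.
(ref: EscauriazaSereginSverak2003, Thms. 1.3–1.4) (ref: Seregin2012, Thm. 1.1) -/
def Row_F6 : Prop := ess_endpoint ∧ seregin_L3_blowup ∧ ladyzhenskaya_prodi_serrin

/-- Row F6 is a theorem of the tree. [cite: EscauriazaSereginSverak2003, Thms. 1.3–1.4] -/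
theorem row_F6_excluded : Row_F6 :=
  ⟨ess_endpoint_holds, seregin_L3_blowup_holds, ladyzhenskaya_prodi_serrin_holds⟩

/-- **Row F6b** (I∨II · no symmetry · supercritical Serrin class `L^q_t L³_x`, `q ∈ (4,5)`, a priori
on a final interval ⇒ continuation).  Verbatim item ⟨19500⟩ `L3TimeExponentPincer.SupercriticalSerrinL3`.
OPEN-WITH-LINE. [cite: EscauriazaSereginSverak2003, §1 (the L³ endpoint)] -/
@[conjecture] def Row_F6b : Prop :=
  ∃ q : ℝ, 4 < q ∧ q < 5 ∧ ∀ (ν T : ℝ), 0 < ν → 0 < T →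
    ∀ (u : ℝ → EuclideanSpace ℝ (Fin 3) → EuclideanSpace ℝ (Fin 3))
      (p : ℝ → EuclideanSpace ℝ (Fin 3) → ℝ),
    IsClassicalNSSolutionOn (Ico 0 T) ν 0 u p → IsLerayHopfOn T ν 0 (u 0) u →
    HasRapidSpatialDecay (u 0) →
    (∃ T₂ ∈ Ioo 0 T, (∫⁻ t in Ioo T₂ T, eLpNorm (u t) 3 volume ^ q) < ⊤) →
    HasSmoothExtensionPast ν 0 u T

/-- **Row F7** (I∨II · no symmetry · Clay ∩ `L^∞_t L^{3,∞}_x` on a final slab, ANY size): a classical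
Leray–Hopf solution from a rapidly decaying datum whose viscosity-normalised slices
`ũ = timeRescale ν⁻¹ ν⁻¹ u` obey `eWeakLpPow (ũ s) 3 ≤ W < ∞` for `s ∈ (S₁, νT)`, `0 ≤ S₁ < νT`, extends
past `T`.  OPEN-NO-LINE (open in print: Lemarié-Rieusset 2016 p. 575); in tree MODULO (L) by
`STH.TypeIliouvilleNoTypeII.TypeIIZoom.hasSmoothExtensionPast_of_weakL3Slab_of_liouvilleL` (same
hypotheses after `(hL : TypeIliouvilleL)`; cited, not imported). [cite: LemarieRieusset2016, Thm 15.6 and p. 575] -/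
@[conjecture] def Row_F7 : Prop :=
  ∀ (ν T : ℝ), 0 < ν → 0 < T →
    ∀ (u : ℝ → EuclideanSpace ℝ (Fin 3) → EuclideanSpace ℝ (Fin 3))
      (p : ℝ → EuclideanSpace ℝ (Fin 3) → ℝ),
    IsClassicalNSSolutionOn (Ico 0 T) ν 0 u p → IsLerayHopfOn T ν 0 (u 0) u →
    HasRapidSpatialDecay (u 0) →
    ∀ (S₁ : ℝ) (W : ℝ≥0∞), 0 ≤ S₁ → S₁ < ν * T → W ≠ ⊤ →
      (∀ s ∈ Ioo S₁ (ν * T), eWeakLpPow (timeRescale ν⁻¹ ν⁻¹ u s) 3 volume ≤ W) →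
      HasSmoothExtensionPast ν 0 u T

/-- F0 contains F7. [folklore] -/
theorem row_F7_of_F0 (h₀ : Row_F0) : Row_F7 :=
  fun ν T hν hT u p hcl hLH hdec _ _ _ _ _ _ => h₀ ν T hν hT u p hcl hLH hdec

/-- **Row F9** (I∨II · suitable weak class · "fat" singular sets): `𝒫¹(Σ) = 0` (CKN 1982) and the
singular times are `ℋ^{1/2}`-null (Leray / Scheffer) — ALIAS of
`ckn_partial_regularity ∧ scheffer_singular_times`, both PROVED.  EXCLUDED-IN-TREE.
(ref: CaffarelliKohnNirenberg1982, Thm B) -/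
def Row_F9 : Prop := ckn_partial_regularity ∧ scheffer_singular_times

/-- Row F9 is a theorem of the tree. [cite: CaffarelliKohnNirenberg1982, Thm B] -/
theorem row_F9_excluded : Row_F9 := ⟨ckn_partial_regularity_holds, scheffer_singular_times_holds⟩

/-- **Row F10** (I∨II · planar 2D · `𝕋²`): global strong solutions (Foias–Manley–Rosa–Temam) —
ALIAS of `fmrt_strong_existence_torus2`, PROVED.  EXCLUDED-IN-TREE (`ℝ²`: row F10′, print only).
(ref: FoiasManleyRosaTemam2001, Thm 7.4 (Ch. II)) -/
def Row_F10 : Prop := fmrt_strong_existence_torus2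

/-- Row F10 is a theorem of the tree. [cite: FoiasManleyRosaTemam2001, Thm 7.4 (Ch. II)] -/
theorem row_F10_excluded : Row_F10 := fmrt_strong_existence_torus2_holds

/-! ## F13 / F14 / F14′: symmetry classes without an axis -/

/-- **Row F13** (I∨II · finite symmetry group · Clay class): for a finite group `G` of linear
isometries of `ℝ³` (orthant = hyperoctahedral `B₃`, dihedral, Kida …), every classical Leray–Hopf
solution from a rapidly decaying `G`-equivariant datum (`u₀ (g x) = g (u₀ x)`) extends past `T`.
The class is flow-invariant, so this is F0 restricted (`row_F13_of_F0`); no regularity theorem uses a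
finite group.  OPEN-NO-LINE (negative-side routes: MirrorChamber, QuantisedSymmetry).
[cite: LemarieRieusset2016, §10.5 (pp. 306–307: symmetric flows, decay only)] -/
@[conjecture] def Row_F13 : Prop :=
  ∀ (G : Subgroup (EuclideanSpace ℝ (Fin 3) ≃ₗᵢ[ℝ] EuclideanSpace ℝ (Fin 3))), Finite G →
  ∀ (ν T : ℝ), 0 < ν → 0 < T →
    ∀ (u : ℝ → EuclideanSpace ℝ (Fin 3) → EuclideanSpace ℝ (Fin 3))
      (p : ℝ → EuclideanSpace ℝ (Fin 3) → ℝ),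
    IsClassicalNSSolutionOn (Ico 0 T) ν 0 u p → IsLerayHopfOn T ν 0 (u 0) u →
    HasRapidSpatialDecay (u 0) → (∀ g ∈ G, ∀ x, u 0 (g x) = g (u 0 x)) →
    HasSmoothExtensionPast ν 0 u T

/-- F0 contains F13. [folklore] -/
theorem row_F13_of_F0 (h₀ : Row_F0) : Row_F13 :=
  fun _ _ ν T hν hT u p hcl hLH hdec _ => h₀ ν T hν hT u p hcl hLH hdec

/-- **Row F14** (exactly Beltrami datum `curl u₀ = λ(x) u₀` on `ℝ³` with finite energy · VACUOUS): a
`C¹` divergence-free (generalised) Beltrami field in `L²(ℝ³)` vanishes identically (Nadirashvili 2014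
/ Chae–Wolf 2016 Rem. 1.4 (ii), `q = 2`), so the cell is empty — the tree theorem
`IsBeltrami.eq_zero_of_integrable_norm_rpow`.  EXCLUDED-IN-TREE (vacuous).
(ref: ChaeWolf2016, Remark 1.4 (ii)) (ref: Nadirashvili2014, Theorem) -/
def Row_F14 : Prop :=
  ∀ (v : EuclideanSpace ℝ (Fin 3) → EuclideanSpace ℝ (Fin 3)) (lam : EuclideanSpace ℝ (Fin 3) → ℝ),
    IsBeltrami v lam → ContDiff ℝ 1 v → VectorCalculus.IsDivFree v →
    Integrable (fun x : EuclideanSpace ℝ (Fin 3) => ‖v x‖ ^ (2 : ℝ)) → v = 0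

/-- Row F14 is a theorem of the tree (`q = 2`). [cite: ChaeWolf2016, Remark 1.4 (ii)] -/
theorem row_F14_excluded : Row_F14 := fun _ _ h hv hdiv hint =>
  h.eq_zero_of_integrable_norm_rpow hv hdiv le_rfl (by norm_num) hint

/-- **Row F14′** (I∨II · (near-)Beltrami · Beale–Kato–Majda class `HasBoundedSobolevNormsOn` on closed
sub-strips): depleted Lamb vector `‖u × ω‖ ≤ a(t)‖u‖‖ω‖` with `a(t)‖∇u(t)‖₂^{1/2} ≤ c` on `[0,T)` ⇒
continuation in the class past `T` (`HasSobolevExtensionPast`) — the statement of the tree theorem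
`nearBeltrami_enstrophy_criterion` (Farhat–Grujić 2018 Thm 1, whole-space form).  EXCLUDED-IN-TREE
(criterion; `𝕋³` twins `Torus.classicalNS_global_stability_of_beltrami_three` etc. by name).
(ref: FarhatGrujic2018, Thm 1 (p. 4)) -/
def Row_F14' : Prop :=
  ∀ (ν T c : ℝ), 0 < ν → 0 < T →
    ∀ (u : ℝ → EuclideanSpace ℝ (Fin 3) → EuclideanSpace ℝ (Fin 3))
      (p : ℝ → EuclideanSpace ℝ (Fin 3) → ℝ) (a : ℝ → ℝ),
    IsClassicalNSSolutionOn (Ico 0 T) ν 0 u p → (∀ T'' < T, HasBoundedSobolevNormsOn (Icc 0 T'') u) →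
    (∀ t ∈ Ico 0 T, 0 ≤ a t) →
    (∀ t ∈ Ico 0 T, ∀ x, ‖cross (u t x) (curl (u t) x)‖ ≤ a t * (‖u t x‖ * ‖curl (u t) x‖)) →
    (∀ t ∈ Ico 0 T, a t * Real.sqrt (Real.sqrt (∫ x, frobeniusNormSq (fderiv ℝ (u t) x))) ≤ c) →
    HasSobolevExtensionPast ν u T

/-- Row F14′ is a theorem of the tree. [cite: FarhatGrujic2018, Thm 1 (p. 4)] -/
theorem row_F14'_excluded : Row_F14' := fun _ _ _ hν hT _ _ _ hsol hreg ha hang hcpl =>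
  nearBeltrami_enstrophy_criterion hν hT hsol hreg ha hang hcpl

end Summit.NavierStokesRegularity.NavierStokesRegularity.Theorems.ScenarioCensus

end
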